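import Mathlib
import HarnessLib
import Summits.NavierStokesRegularity.NavierStokesRegularity.Theorems.PoloidalWindowDoorLrcModEntireTwistingTHLocalNonUmbilic
import Summits.NavierStokesRegularity.NavierStokesRegularity.Theorems.PoloidalWindowDoorLrcModEntireTwistingTHLocalGalilean
import Summits.NavierStokesRegularity.NavierStokesRegularity.Theorems.PoloidalWindowDoorLrcModEntireTwistingTHSparseBoost

/-!
# Route `PoloidalWindowDoor`, crux `PoloidalWindowRigidity` (stmt-19708) / item `LrcModEntire` (stmt-20428), line `sparse_energy` —
# the SOURCE-FREE local (TH)∩twisting statement: NON-UMBILIC base point and GALILEAN rest point (first two normal-form steps of v4.4)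

Seat ns-poloidal-K2-p2 g9 (successor of the interim LEAD-of-record on 19708; file `--supports`).  K2-p2 g7's normal-form steps
`…TwistingTHLocalNonUmbilic.localTHEmptyHyp_of_localTHEmptyHypNonUmbilic` (p585858) and `…TwistingTHLocalGalilean.localTHEmptyHypNonUmbilic_of_galilean`
(p586459) RE-RUN WITH THE PRESSURE DATUM TRACKED, for the source-free statement of K-sparse profiles (`…TwistingTHSparse`: `hemptyHypSF` =
`hemptyHyp` + `∀ p ∈ U, A p.1 (p.2 2) = 0`):

* `localTHEmptyHypSF_of_nonUmbilicSF` — `hemptyHypSF ⇐ hemptyHypSF_NU` (`hemptyHypSF` with the non-umbilic pin; the relocation keeps `(u, μ, A, U)`, so `A ≡ 0`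
  rides along; proof = p585858's verbatim);
* `nonUmbilicSF_of_galileanSF` — `hemptyHypSF_NU ⇐ hemptyHypSF_NUG`, where **`hemptyHypSF_NUG`** is K2-p2 g7's `hemptyHypNUG` (rest point `u(p₀) = 0`) with the
  A-hypothesis `∃ k : ℝ, ∀ p ∈ U, A p.1 (p.2 2) = k·(∂ₜμ − ∂_z²μ)(p) − (k²/2)·∂_zμ(p)` — THE EXPLICIT REST-FRAME DATUM (one real scalar `k = c₂ = u₂(p₀)` of the boost;
  sign of the `k²` term MINUS, `…TwistingTHSparseBoost.boostedDatum_eq`); proof = p586459's verbatim + the datum identity.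

So on K-sparse profiles the local target of the (TH) column may be taken in the form «no real-analytic `(u, μ)` and real `k` on an open `U ∋ p₀` with the four local
laws, E with datum `k(∂ₜμ − ∂_z²μ) − (k²/2)∂_zμ`, the pins, `μ < 0`, non-umbilic, `u(p₀) = 0`» — K2-p3's v4.4 `stub_localTHEmptySFRS` up to the rotation/scaling gauge
(those two steps, p607457/p607864, preserve the form with `k ↦ k` resp. `k ↦ λk`; not re-run here).

WHAT THIS IS NOT: not a proof of any stub and not a claim about Navier–Stokes — two reductions (bears_on LADDER-NS N0 via 19708/20428). [folklore]
-/

noncomputable section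

-- the summit and its single sub-problem share the name (CONVENTIONS §1), as in every Theorems file
set_option linter.dupNamespace false

namespace Summit.NavierStokesRegularity.NavierStokesRegularity.Theorems.PoloidalWindowDoorLrcModEntireTwistingTHSparseNormalForm

open Set Function Filter Topology Metric
open scoped RealInnerProductSpace InnerProductSpace Laplacian
open Literature.Analysis Literature.Analysis.FluidPDE
open Summit.NavierStokesRegularity.NavierStokesRegularity.Theorems.PoloidalWindowDoorLrcModEntireTwistingThickLeafwise
open Summit.NavierStokesRegularity.NavierStokesRegularity.Theorems.PoloidalWindowDoorLrcModEntireJetLetters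
open Summit.NavierStokesRegularity.NavierStokesRegularity.Theorems.PoloidalWindowDoorLrcModEntireTHCertLetters
open Summit.NavierStokesRegularity.NavierStokesRegularity.Theorems.PoloidalWindowDoorLrcModEntireTHCertDictionary
open Summit.NavierStokesRegularity.NavierStokesRegularity.Theorems.PoloidalWindowDoorPoloidalWindowRigiditySlopeFunctionSource
open Summit.NavierStokesRegularity.NavierStokesRegularity.Theorems.PoloidalWindowDoorLrcModEntireTwistingTHLocalNonUmbilic
open Summit.NavierStokesRegularity.NavierStokesRegularity.Theorems.PoloidalWindowDoorLrcModEntireTwistingTHLocalGalilean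

/-! ### Step 1: non-umbilic base point (A ≡ 0 rides along) -/

/-- **`hemptyHypSF ⇐ hemptyHypSF_NU`** — the source-free hyperbolic local (TH)∩twisting statement may assume a NON-UMBILIC base point
(`∂₀u₀(p₀) ≠ ∂₁u₁(p₀) ∨ ∂₁u₀(p₀) ≠ 0`); p585858's relocation verbatim, the datum `A ≡ 0` on `U` unchanged. [folklore] -/
theorem localTHEmptyHypSF_of_nonUmbilicSF
    (hNU : ∀ (u : ℝ → EuclideanSpace ℝ (Fin 3) → EuclideanSpace ℝ (Fin 3)) (μ A : ℝ → ℝ → ℝ)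
      (U : Set (ℝ × EuclideanSpace ℝ (Fin 3))) (p₀ : ℝ × EuclideanSpace ℝ (Fin 3)),
      IsOpen U → p₀ ∈ U →
      AnalyticOnNhd ℝ (Function.uncurry u) U →
      (∀ p ∈ U, AnalyticAt ℝ (Function.uncurry μ) (p.1, p.2 2)) →
      (∀ p ∈ U, AnalyticAt ℝ (Function.uncurry A) (p.1, p.2 2)) →
      (∀ p ∈ U, fderiv ℝ (u p.1) p.2 (EuclideanSpace.single 0 1) 1 = fderiv ℝ (u p.1) p.2 (EuclideanSpace.single 1 1) 0) →
      (∀ p ∈ U, fderiv ℝ (u p.1) p.2 (EuclideanSpace.single 0 1) 0 + fderiv ℝ (u p.1) p.2 (EuclideanSpace.single 1 1) 1 +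
        fderiv ℝ (u p.1) p.2 (EuclideanSpace.single 2 1) 2 = 0) →
      (∀ p ∈ U, ∀ b : Fin 3, b ≠ 2 →
        fderiv ℝ (u p.1) p.2 (EuclideanSpace.single 2 1) b =
          μ p.1 (p.2 2) * fderiv ℝ (u p.1) p.2 (EuclideanSpace.single b 1) 2) →
      (∀ p ∈ U,
        (1 - μ p.1 (p.2 2)) *
            (deriv (fun s => u s p.2 2) p.1 + fderiv ℝ (fun y => u p.1 y 2) p.2 (u p.1 p.2)
              - Δ (fun y => u p.1 y 2) p.2) =
          A p.1 (p.2 2) + (deriv (fun s => μ s (p.2 2)) p.1 - deriv (deriv (μ p.1)) (p.2 2)) * u p.1 p.2 2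
            + deriv (μ p.1) (p.2 2) / 2 * u p.1 p.2 2 ^ 2
            - 2 * deriv (μ p.1) (p.2 2) * fderiv ℝ (u p.1) p.2 (EuclideanSpace.single 2 1) 2) →
      fderiv ℝ (fun y => fderiv ℝ (u p₀.1) y (EuclideanSpace.single 2 1) 2) p₀.2 (EuclideanSpace.single 0 1) *
            fderiv ℝ (u p₀.1) p₀.2 (EuclideanSpace.single 1 1) 2 -
          fderiv ℝ (fun y => fderiv ℝ (u p₀.1) y (EuclideanSpace.single 2 1) 2) p₀.2 (EuclideanSpace.single 1 1) *
            fderiv ℝ (u p₀.1) p₀.2 (EuclideanSpace.single 0 1) 2 ≠ 0 →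
      μ p₀.1 (p₀.2 2) ≠ 0 → μ p₀.1 (p₀.2 2) ≠ 1 → deriv (μ p₀.1) (p₀.2 2) ≠ 0 →
      μ p₀.1 (p₀.2 2) < 0 →
      (∀ p ∈ U, A p.1 (p.2 2) = 0) →
      (fderiv ℝ (u p₀.1) p₀.2 (EuclideanSpace.single 0 1) 0 ≠ fderiv ℝ (u p₀.1) p₀.2 (EuclideanSpace.single 1 1) 1 ∨
        fderiv ℝ (u p₀.1) p₀.2 (EuclideanSpace.single 1 1) 0 ≠ 0) → False) :
    ∀ (u : ℝ → EuclideanSpace ℝ (Fin 3) → EuclideanSpace ℝ (Fin 3)) (μ A : ℝ → ℝ → ℝ)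
      (U : Set (ℝ × EuclideanSpace ℝ (Fin 3))) (p₀ : ℝ × EuclideanSpace ℝ (Fin 3)),
      IsOpen U → p₀ ∈ U →
      AnalyticOnNhd ℝ (Function.uncurry u) U →
      (∀ p ∈ U, AnalyticAt ℝ (Function.uncurry μ) (p.1, p.2 2)) →
      (∀ p ∈ U, AnalyticAt ℝ (Function.uncurry A) (p.1, p.2 2)) →
      (∀ p ∈ U, fderiv ℝ (u p.1) p.2 (EuclideanSpace.single 0 1) 1 = fderiv ℝ (u p.1) p.2 (EuclideanSpace.single 1 1) 0) →
      (∀ p ∈ U, fderiv ℝ (u p.1) p.2 (EuclideanSpace.single 0 1) 0 + fderiv ℝ (u p.1) p.2 (EuclideanSpace.single 1 1) 1 +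
        fderiv ℝ (u p.1) p.2 (EuclideanSpace.single 2 1) 2 = 0) →
      (∀ p ∈ U, ∀ b : Fin 3, b ≠ 2 →
        fderiv ℝ (u p.1) p.2 (EuclideanSpace.single 2 1) b =
          μ p.1 (p.2 2) * fderiv ℝ (u p.1) p.2 (EuclideanSpace.single b 1) 2) →
      (∀ p ∈ U,
        (1 - μ p.1 (p.2 2)) *
            (deriv (fun s => u s p.2 2) p.1 + fderiv ℝ (fun y => u p.1 y 2) p.2 (u p.1 p.2)
              - Δ (fun y => u p.1 y 2) p.2) =
          A p.1 (p.2 2) + (deriv (fun s => μ s (p.2 2)) p.1 - deriv (deriv (μ p.1)) (p.2 2)) * u p.1 p.2 2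
            + deriv (μ p.1) (p.2 2) / 2 * u p.1 p.2 2 ^ 2
            - 2 * deriv (μ p.1) (p.2 2) * fderiv ℝ (u p.1) p.2 (EuclideanSpace.single 2 1) 2) →
      fderiv ℝ (fun y => fderiv ℝ (u p₀.1) y (EuclideanSpace.single 2 1) 2) p₀.2 (EuclideanSpace.single 0 1) *
            fderiv ℝ (u p₀.1) p₀.2 (EuclideanSpace.single 1 1) 2 -
          fderiv ℝ (fun y => fderiv ℝ (u p₀.1) y (EuclideanSpace.single 2 1) 2) p₀.2 (EuclideanSpace.single 1 1) *
            fderiv ℝ (u p₀.1) p₀.2 (EuclideanSpace.single 0 1) 2 ≠ 0 →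
      μ p₀.1 (p₀.2 2) ≠ 0 → μ p₀.1 (p₀.2 2) ≠ 1 → deriv (μ p₀.1) (p₀.2 2) ≠ 0 →
      μ p₀.1 (p₀.2 2) < 0 →
      (∀ p ∈ U, A p.1 (p.2 2) = 0) → False := by
  intro u μ A U p₀ hU hp₀ hu hμ hA hpol hdiv hsh hE htw hm0 hm1 hmz hneg hA0
  -- the pinned open set `G ∋ p₀`
  set tw : ℝ × EuclideanSpace ℝ (Fin 3) → ℝ := fun p =>
    fderiv ℝ (fun y => fderiv ℝ (u p.1) y (EuclideanSpace.single 2 1) 2) p.2 (EuclideanSpace.single 0 1) *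
        fderiv ℝ (u p.1) p.2 (EuclideanSpace.single 1 1) 2 -
      fderiv ℝ (fun y => fderiv ℝ (u p.1) y (EuclideanSpace.single 2 1) 2) p.2 (EuclideanSpace.single 1 1) *
        fderiv ℝ (u p.1) p.2 (EuclideanSpace.single 0 1) 2 with htwdef
  set sl : ℝ × EuclideanSpace ℝ (Fin 3) → ℝ := fun p => μ p.1 (p.2 2) with hsldef
  set slz : ℝ × EuclideanSpace ℝ (Fin 3) → ℝ := fun p => deriv (μ p.1) (p.2 2) with hslzdef
  have hT : IsOpen (({0}ᶜ ∩ {1}ᶜ) ∩ Iio (0 : ℝ)) := (isOpen_compl_singleton.inter isOpen_compl_singleton).inter isOpen_Iio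
  set G : Set (ℝ × EuclideanSpace ℝ (Fin 3)) :=
    ((U ∩ tw ⁻¹' {0}ᶜ) ∩ (U ∩ sl ⁻¹' (({0}ᶜ ∩ {1}ᶜ) ∩ Iio 0))) ∩ (U ∩ slz ⁻¹' {0}ᶜ) with hGdef
  have hGo : IsOpen G :=
    (((continuousOn_twist hU hu).isOpen_inter_preimage hU isOpen_compl_singleton).inter
      ((continuousOn_slope hμ).isOpen_inter_preimage hU hT)).inter
        ((continuousOn_slopeZ hμ).isOpen_inter_preimage hU isOpen_compl_singleton)
  have hp₀G : p₀ ∈ G := by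
    refine ⟨⟨⟨hp₀, ?_⟩, hp₀, ?_⟩, hp₀, ?_⟩
    · simpa [htwdef] using htw
    · simpa [hsldef] using ⟨⟨hm0, hm1⟩, hneg⟩
    · simpa [hslzdef] using hmz
  have hGU : G ⊆ U := fun p hp => hp.1.1.1
  -- dichotomy: a non-umbilic point of `G`, or `G` umbilic
  by_cases hex : ∃ p₁ ∈ G,
      (fderiv ℝ (u p₁.1) p₁.2 (EuclideanSpace.single 0 1) 0 ≠ fderiv ℝ (u p₁.1) p₁.2 (EuclideanSpace.single 1 1) 1 ∨
        fderiv ℝ (u p₁.1) p₁.2 (EuclideanSpace.single 1 1) 0 ≠ 0)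
  · obtain ⟨p₁, hp₁G, hΦ⟩ := hex
    have htw₁ : tw p₁ ≠ 0 := by simpa using hp₁G.1.1.2
    have hsl₁ : (sl p₁ ≠ 0 ∧ sl p₁ ≠ 1) ∧ sl p₁ < 0 := by simpa using hp₁G.1.2.2
    have hslz₁ : slz p₁ ≠ 0 := by simpa using hp₁G.2.2
    exact hNU u μ A U p₁ hU (hGU hp₁G) hu hμ hA hpol hdiv hsh hE htw₁ hsl₁.1.1 hsl₁.1.2 hslz₁ hsl₁.2 hA0 hΦ
  · push Not at hex
    exact htw (twist_eq_zero_of_umbilic hGo (hu.mono hGU) (fun p hp => hpol p (hGU hp)) (fun p hp => hdiv p (hGU hp))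
      hex hp₀G)

/-! ### Step 2: Galilean rest point (A ≡ 0 becomes the explicit rest-frame datum) -/

/-- **`hemptyHypSF_NU ⇐ hemptyHypSF_NUG`** — the source-free statement with non-umbilic pin may assume `u(p₀) = 0`; after the boost by `c = u(p₀)`
the datum is the EXPLICIT `k(∂ₜμ − ∂_z²μ) − (k²/2)∂_zμ` in the boosted slope, `k = c₂` (p586459's Galilean covariance + `boostedDatum_eq`). [folklore] -/
theorem nonUmbilicSF_of_galileanSF
    (hG : ∀ (u : ℝ → EuclideanSpace ℝ (Fin 3) → EuclideanSpace ℝ (Fin 3)) (μ A : ℝ → ℝ → ℝ)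
      (U : Set (ℝ × EuclideanSpace ℝ (Fin 3))) (p₀ : ℝ × EuclideanSpace ℝ (Fin 3)),
      IsOpen U → p₀ ∈ U →
      AnalyticOnNhd ℝ (Function.uncurry u) U →
      (∀ p ∈ U, AnalyticAt ℝ (Function.uncurry μ) (p.1, p.2 2)) →
      (∀ p ∈ U, AnalyticAt ℝ (Function.uncurry A) (p.1, p.2 2)) →
      (∀ p ∈ U, fderiv ℝ (u p.1) p.2 (EuclideanSpace.single 0 1) 1 = fderiv ℝ (u p.1) p.2 (EuclideanSpace.single 1 1) 0) →
      (∀ p ∈ U, fderiv ℝ (u p.1) p.2 (EuclideanSpace.single 0 1) 0 + fderiv ℝ (u p.1) p.2 (EuclideanSpace.single 1 1) 1 +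
        fderiv ℝ (u p.1) p.2 (EuclideanSpace.single 2 1) 2 = 0) →
      (∀ p ∈ U, ∀ b : Fin 3, b ≠ 2 →
        fderiv ℝ (u p.1) p.2 (EuclideanSpace.single 2 1) b =
          μ p.1 (p.2 2) * fderiv ℝ (u p.1) p.2 (EuclideanSpace.single b 1) 2) →
      (∀ p ∈ U,
        (1 - μ p.1 (p.2 2)) *
            (deriv (fun s => u s p.2 2) p.1 + fderiv ℝ (fun y => u p.1 y 2) p.2 (u p.1 p.2)
              - Δ (fun y => u p.1 y 2) p.2) =
          A p.1 (p.2 2) + (deriv (fun s => μ s (p.2 2)) p.1 - deriv (deriv (μ p.1)) (p.2 2)) * u p.1 p.2 2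
            + deriv (μ p.1) (p.2 2) / 2 * u p.1 p.2 2 ^ 2
            - 2 * deriv (μ p.1) (p.2 2) * fderiv ℝ (u p.1) p.2 (EuclideanSpace.single 2 1) 2) →
      fderiv ℝ (fun y => fderiv ℝ (u p₀.1) y (EuclideanSpace.single 2 1) 2) p₀.2 (EuclideanSpace.single 0 1) *
            fderiv ℝ (u p₀.1) p₀.2 (EuclideanSpace.single 1 1) 2 -
          fderiv ℝ (fun y => fderiv ℝ (u p₀.1) y (EuclideanSpace.single 2 1) 2) p₀.2 (EuclideanSpace.single 1 1) *
            fderiv ℝ (u p₀.1) p₀.2 (EuclideanSpace.single 0 1) 2 ≠ 0 →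
      μ p₀.1 (p₀.2 2) ≠ 0 → μ p₀.1 (p₀.2 2) ≠ 1 → deriv (μ p₀.1) (p₀.2 2) ≠ 0 →
      μ p₀.1 (p₀.2 2) < 0 →
      (∃ k : ℝ, ∀ p ∈ U, A p.1 (p.2 2) =
        k * (deriv (fun s => μ s (p.2 2)) p.1 - deriv (deriv (μ p.1)) (p.2 2)) - k ^ 2 / 2 * deriv (μ p.1) (p.2 2)) →
      (fderiv ℝ (u p₀.1) p₀.2 (EuclideanSpace.single 0 1) 0 ≠ fderiv ℝ (u p₀.1) p₀.2 (EuclideanSpace.single 1 1) 1 ∨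
        fderiv ℝ (u p₀.1) p₀.2 (EuclideanSpace.single 1 1) 0 ≠ 0) →
      u p₀.1 p₀.2 = 0 → False) :
    ∀ (u : ℝ → EuclideanSpace ℝ (Fin 3) → EuclideanSpace ℝ (Fin 3)) (μ A : ℝ → ℝ → ℝ)
      (U : Set (ℝ × EuclideanSpace ℝ (Fin 3))) (p₀ : ℝ × EuclideanSpace ℝ (Fin 3)),
      IsOpen U → p₀ ∈ U →
      AnalyticOnNhd ℝ (Function.uncurry u) U →
      (∀ p ∈ U, AnalyticAt ℝ (Function.uncurry μ) (p.1, p.2 2)) →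
      (∀ p ∈ U, AnalyticAt ℝ (Function.uncurry A) (p.1, p.2 2)) →
      (∀ p ∈ U, fderiv ℝ (u p.1) p.2 (EuclideanSpace.single 0 1) 1 = fderiv ℝ (u p.1) p.2 (EuclideanSpace.single 1 1) 0) →
      (∀ p ∈ U, fderiv ℝ (u p.1) p.2 (EuclideanSpace.single 0 1) 0 + fderiv ℝ (u p.1) p.2 (EuclideanSpace.single 1 1) 1 +
        fderiv ℝ (u p.1) p.2 (EuclideanSpace.single 2 1) 2 = 0) →
      (∀ p ∈ U, ∀ b : Fin 3, b ≠ 2 →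
        fderiv ℝ (u p.1) p.2 (EuclideanSpace.single 2 1) b =
          μ p.1 (p.2 2) * fderiv ℝ (u p.1) p.2 (EuclideanSpace.single b 1) 2) →
      (∀ p ∈ U,
        (1 - μ p.1 (p.2 2)) *
            (deriv (fun s => u s p.2 2) p.1 + fderiv ℝ (fun y => u p.1 y 2) p.2 (u p.1 p.2)
              - Δ (fun y => u p.1 y 2) p.2) =
          A p.1 (p.2 2) + (deriv (fun s => μ s (p.2 2)) p.1 - deriv (deriv (μ p.1)) (p.2 2)) * u p.1 p.2 2
            + deriv (μ p.1) (p.2 2) / 2 * u p.1 p.2 2 ^ 2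
            - 2 * deriv (μ p.1) (p.2 2) * fderiv ℝ (u p.1) p.2 (EuclideanSpace.single 2 1) 2) →
      fderiv ℝ (fun y => fderiv ℝ (u p₀.1) y (EuclideanSpace.single 2 1) 2) p₀.2 (EuclideanSpace.single 0 1) *
            fderiv ℝ (u p₀.1) p₀.2 (EuclideanSpace.single 1 1) 2 -
          fderiv ℝ (fun y => fderiv ℝ (u p₀.1) y (EuclideanSpace.single 2 1) 2) p₀.2 (EuclideanSpace.single 1 1) *
            fderiv ℝ (u p₀.1) p₀.2 (EuclideanSpace.single 0 1) 2 ≠ 0 →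
      μ p₀.1 (p₀.2 2) ≠ 0 → μ p₀.1 (p₀.2 2) ≠ 1 → deriv (μ p₀.1) (p₀.2 2) ≠ 0 →
      μ p₀.1 (p₀.2 2) < 0 →
      (∀ p ∈ U, A p.1 (p.2 2) = 0) →
      (fderiv ℝ (u p₀.1) p₀.2 (EuclideanSpace.single 0 1) 0 ≠ fderiv ℝ (u p₀.1) p₀.2 (EuclideanSpace.single 1 1) 1 ∨
        fderiv ℝ (u p₀.1) p₀.2 (EuclideanSpace.single 1 1) 0 ≠ 0) → False := by
  intro u μ A U p₀ hU hp₀ hu hμ hA hpol hdiv hsh hE htw hm0 hm1 hmz hneg hA0 hNU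
  obtain ⟨t₀, x₀⟩ := p₀
  set c : EuclideanSpace ℝ (Fin 3) := u t₀ x₀ with hc
  -- the shear and the boosted datum
  set τ : ℝ × EuclideanSpace ℝ (Fin 3) → ℝ × EuclideanSpace ℝ (Fin 3) := fun p => (p.1, p.2 + (p.1 - t₀) • c) with hτ
  set u' : ℝ → EuclideanSpace ℝ (Fin 3) → EuclideanSpace ℝ (Fin 3) := fun s z => u s (z + (s - t₀) • c) - c with hu'
  set μ' : ℝ → ℝ → ℝ := fun s ζ => μ s (ζ + (s - t₀) * c 2) with hμ'
  set A' : ℝ → ℝ → ℝ := fun s ζ => A s (ζ + (s - t₀) * c 2) +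
      c 2 * (jetLetter (uncurry μ) (word2 1 0) (s, ζ + (s - t₀) * c 2) -
        jetLetter (uncurry μ) (word2 0 2) (s, ζ + (s - t₀) * c 2)) +
      c 2 ^ 2 / 2 * jetLetter (uncurry μ) (word2 0 1) (s, ζ + (s - t₀) * c 2) with hA'
  set U' : Set (ℝ × EuclideanSpace ℝ (Fin 3)) := τ ⁻¹' U with hU'
  have hτc : Continuous τ := by rw [hτ]; fun_prop
  have hτa : ∀ p, AnalyticAt ℝ τ p := fun p => by
    rw [hτ]
    exact analyticAt_fst.prod (analyticAt_snd.add ((analyticAt_fst.sub analyticAt_const).smul analyticAt_const))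
  have hτ2 : ∀ p : ℝ × EuclideanSpace ℝ (Fin 3), ((τ p).1, (τ p).2 2) = (p.1, p.2 2 + (p.1 - t₀) * c 2) := fun p => by
    rw [hτ]; simp
  -- the shear on shadows
  have hsha : ∀ q : ℝ × ℝ, AnalyticAt ℝ (fun q : ℝ × ℝ => ((q.1, q.2 + (q.1 - t₀) * c 2) : ℝ × ℝ)) q := fun q =>
    analyticAt_fst.prod (analyticAt_snd.add ((analyticAt_fst.sub analyticAt_const).mul analyticAt_const))
  have hU'o : IsOpen U' := hU.preimage hτc
  have hτ₀ : τ (t₀, x₀) = (t₀, x₀) := by rw [hτ]; simp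
  have hp₀' : ((t₀, x₀) : ℝ × EuclideanSpace ℝ (Fin 3)) ∈ U' := by
    show τ (t₀, x₀) ∈ U; rw [hτ₀]; exact hp₀
  -- analyticity of the boosted datum
  have hu'a : AnalyticOnNhd ℝ (uncurry u') U' := by
    intro p hp
    have h := ((hu (τ p) hp).comp (hτa p)).sub (analyticAt_const (v := c))
    refine h.congr (Eventually.of_forall fun q => ?_)
    obtain ⟨s, z⟩ := q; rfl
  have hμ'a : ∀ p ∈ U', AnalyticAt ℝ (uncurry μ') (p.1, p.2 2) := by
    intro p hp
    have h1 : AnalyticAt ℝ (uncurry μ) (p.1, p.2 2 + (p.1 - t₀) * c 2) := by rw [← hτ2]; exact hμ (τ p) hp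
    have h := AnalyticAt.comp (f := fun q : ℝ × ℝ => ((q.1, q.2 + (q.1 - t₀) * c 2) : ℝ × ℝ)) (x := (p.1, p.2 2))
      h1 (hsha (p.1, p.2 2))
    refine h.congr (Eventually.of_forall fun q => ?_)
    obtain ⟨s, ζ⟩ := q; rfl
  have hA'a : ∀ p ∈ U', AnalyticAt ℝ (uncurry A') (p.1, p.2 2) := by
    intro p hp
    have hm : ((p.1, p.2 2 + (p.1 - t₀) * c 2) : ℝ × ℝ) ∈ analyticSet μ := by
      show AnalyticAt ℝ (uncurry μ) _; rw [← hτ2]; exact hμ (τ p) hp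
    have hJ : ∀ w, AnalyticAt ℝ (fun q : ℝ × ℝ => jetLetter (uncurry μ) w (q.1, q.2 + (q.1 - t₀) * c 2)) (p.1, p.2 2) :=
      fun w => AnalyticAt.comp (f := fun q : ℝ × ℝ => ((q.1, q.2 + (q.1 - t₀) * c 2) : ℝ × ℝ)) (x := (p.1, p.2 2))
        (analyticOnNhd_jetLetter (analyticOnNhd_analyticSet μ) w _ hm) (hsha (p.1, p.2 2))
    have hA1 : AnalyticAt ℝ (fun q : ℝ × ℝ => A q.1 (q.2 + (q.1 - t₀) * c 2)) (p.1, p.2 2) := by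
      have h1 : AnalyticAt ℝ (uncurry A) (p.1, p.2 2 + (p.1 - t₀) * c 2) := by rw [← hτ2]; exact hA (τ p) hp
      have h := AnalyticAt.comp (f := fun q : ℝ × ℝ => ((q.1, q.2 + (q.1 - t₀) * c 2) : ℝ × ℝ)) (x := (p.1, p.2 2))
        h1 (hsha (p.1, p.2 2))
      refine h.congr (Eventually.of_forall fun q => ?_)
      obtain ⟨s, ζ⟩ := q; rfl
    have h := (hA1.add ((analyticAt_const (v := c 2)).mul ((hJ (word2 1 0)).sub (hJ (word2 0 2))))).add
      ((analyticAt_const (v := c 2 ^ 2 / 2)).mul (hJ (word2 0 1)))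
    refine h.congr (Eventually.of_forall fun q => ?_)
    obtain ⟨s, ζ⟩ := q; rfl
  -- the kinematic identities transfer pointwise through the translated jets
  have hent : ∀ p : ℝ × EuclideanSpace ℝ (Fin 3), ∀ e : EuclideanSpace ℝ (Fin 3), ∀ i : Fin 3,
      fderiv ℝ (u' p.1) p.2 e i = fderiv ℝ (u (τ p).1) (τ p).2 e i := fun p e i => by
    rw [hu', hτ]; dsimp only; rw [fderiv_boost]
  have hslope : ∀ p : ℝ × EuclideanSpace ℝ (Fin 3), μ' p.1 (p.2 2) = μ (τ p).1 ((τ p).2 2) := fun p => by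
    rw [hμ', hτ]; simp
  have hpol' : ∀ p ∈ U', fderiv ℝ (u' p.1) p.2 (EuclideanSpace.single 0 1) 1 =
      fderiv ℝ (u' p.1) p.2 (EuclideanSpace.single 1 1) 0 := fun p hp => by
    rw [hent, hent]; exact hpol (τ p) hp
  have hdiv' : ∀ p ∈ U', fderiv ℝ (u' p.1) p.2 (EuclideanSpace.single 0 1) 0 +
      fderiv ℝ (u' p.1) p.2 (EuclideanSpace.single 1 1) 1 + fderiv ℝ (u' p.1) p.2 (EuclideanSpace.single 2 1) 2 = 0 :=
    fun p hp => by rw [hent, hent, hent]; exact hdiv (τ p) hp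
  have hsh' : ∀ p ∈ U', ∀ b : Fin 3, b ≠ 2 → fderiv ℝ (u' p.1) p.2 (EuclideanSpace.single 2 1) b =
      μ' p.1 (p.2 2) * fderiv ℝ (u' p.1) p.2 (EuclideanSpace.single b 1) 2 := fun p hp b hb => by
    rw [hent, hent, hslope]; exact hsh (τ p) hp b hb
  -- the scalar law transfers by Galilean covariance
  have hE' : ∀ p ∈ U',
      (1 - μ' p.1 (p.2 2)) *
          (deriv (fun s => u' s p.2 2) p.1 + fderiv ℝ (fun y => u' p.1 y 2) p.2 (u' p.1 p.2)
            - Δ (fun y => u' p.1 y 2) p.2) =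
        A' p.1 (p.2 2) + (deriv (fun s => μ' s (p.2 2)) p.1 - deriv (deriv (μ' p.1)) (p.2 2)) * u' p.1 p.2 2
          + deriv (μ' p.1) (p.2 2) / 2 * u' p.1 p.2 2 ^ 2
          - 2 * deriv (μ' p.1) (p.2 2) * fderiv ℝ (u' p.1) p.2 (EuclideanSpace.single 2 1) 2 := by
    intro p hp
    obtain ⟨t, y⟩ := p
    have hq : ((t, y + (t - t₀) • c) : ℝ × EuclideanSpace ℝ (Fin 3)) ∈ U := hp
    have hEq := hE _ hq
    dsimp only at hEq
    have h10 := letterFn_M10 (u := u) (A := A) hμ hq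
    have h01 := letterFn_M01 (u := u) (A := A) hμ hq
    have h02 := letterFn_M02 (u := u) (A := A) hμ hq
    simp only [letterFn, shear_apply_two] at h10 h01 h02
    have hG := galilean_E (A := A) hu hμ t₀ c hq hEq
    rw [hu', hμ', hA']
    dsimp only
    rw [h10, h01, h02]
    exact hG
  -- the pins at `p₀` are unchanged and `u′(p₀) = 0`
  have hent₀ : ∀ e : EuclideanSpace ℝ (Fin 3), ∀ i : Fin 3, fderiv ℝ (u' t₀) x₀ e i = fderiv ℝ (u t₀) x₀ e i :=
    fun e i => by have h := hent (t₀, x₀) e i; rwa [hτ₀] at h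
  have hent2₀ : ∀ e : EuclideanSpace ℝ (Fin 3),
      fderiv ℝ (fun y => fderiv ℝ (u' t₀) y (EuclideanSpace.single 2 1) 2) x₀ e =
        fderiv ℝ (fun y => fderiv ℝ (u t₀) y (EuclideanSpace.single 2 1) 2) x₀ e := fun e => by
    rw [hu']; dsimp only; rw [fderiv_fderiv_boost]; simp
  have hsl₀ : μ' t₀ (x₀ 2) = μ t₀ (x₀ 2) := by rw [hμ']; simp
  have hslz₀ : deriv (μ' t₀) (x₀ 2) = deriv (μ t₀) (x₀ 2) := by
    rw [hμ']; dsimp only; rw [deriv_boostSlope]; simp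
  have hrest : u' t₀ x₀ = 0 := by rw [hu']; simp [hc]
  -- the SOURCE-FREE datum in rest-frame variables: A ≡ 0 on U ⇒ A′ = k(∂ₜμ′ − ∂_z²μ′) − (k²/2)∂_zμ′ with k = c₂ (`…TwistingTHSparseBoost.boostedDatum_eq`)
  have hSF : ∃ k : ℝ, ∀ p ∈ U', A' p.1 (p.2 2) =
      k * (deriv (fun s => μ' s (p.2 2)) p.1 - deriv (deriv (μ' p.1)) (p.2 2)) - k ^ 2 / 2 * deriv (μ' p.1) (p.2 2) := by
    refine ⟨c 2, fun p hp => ?_⟩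
    obtain ⟨t, y⟩ := p
    have hq : ((t, y + (t - t₀) • c) : ℝ × EuclideanSpace ℝ (Fin 3)) ∈ U := hp
    have h10 := letterFn_M10 (u := u) (A := A) hμ hq
    have h01 := letterFn_M01 (u := u) (A := A) hμ hq
    have h02 := letterFn_M02 (u := u) (A := A) hμ hq
    simp only [letterFn, shear_apply_two] at h10 h01 h02
    have hz : A t (y 2 + (t - t₀) * c 2) = 0 := by
      have h := hA0 _ hq
      simp only [shear_apply_two] at h
      simpa using h
    have hμd : DifferentiableAt ℝ (uncurry μ) (t, y 2 + (t - t₀) * c 2) := by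
      have h := hμ _ hq
      simp only [shear_apply_two] at h
      simpa using h.differentiableAt
    rw [hμ', hA']
    dsimp only
    rw [h10, h01, h02, hz, zero_add]
    exact PoloidalWindowDoorLrcModEntireTwistingTHSparseBoost.boostedDatum_eq μ t₀ (c 2) hμd
  refine hG u' μ' A' U' (t₀, x₀) hU'o hp₀' hu'a hμ'a hA'a hpol' hdiv' hsh' hE' ?_ ?_ ?_ ?_ ?_ hSF ?_ hrest
  · simp only [hent₀, hent2₀]; exact htw
  · simp only [hsl₀]; exact hm0
  · simp only [hsl₀]; exact hm1
  · simp only [hslz₀]; exact hmz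
  · simp only [hsl₀]; exact hneg
  · simp only [hent₀]; exact hNU

end Summit.NavierStokesRegularity.NavierStokesRegularity.Theorems.PoloidalWindowDoorLrcModEntireTwistingTHSparseNormalForm

end
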